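/-
Copyright (c) 2026. All rights reserved.
Released under Apache 2.0 license as described in the file LICENSE.

[NoBLE17] = Fitzner–van der Hofstad, "Generalized approach to the non-backtracking lace expansion",
Probab. Theory Relat. Fields 169 (2017) 1041–1119.  [FvdH17] = —, "Mean-field behavior for nearest-neighbor
percolation in d > 10", Electron. J. Probab. 22 (2017) no. 43.  Page numbers below are PTRF / EJP pages.
-/
import Literature.Probability.FitznerVanDerHofstad2017.NobleSimplifiedFormF3AppD
import Literature.Probability.FitznerVanDerHofstad2017.NobleSimplifiedFormF3Mono
import Literature.Probability.FitznerVanDerHofstad2017.NobleRemainderSymmetrisation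
import HarnessLib

/-!
# From Assumption 4.3 to the key-quantity bounds of §3.3.4 — the App.-D line delivered at the `f₃` doorstep

Composition, no new mathematics.  For percolation at `0 < p < p_c(d)`, `d ≥ 2`:

* `nobleSimplifiedFormF3At_percolation₉` — [NoBLE17] Prop. 4.5 (ii) with App. D FULLY discharged and the NoBLE
  equation derived: Assumption 4.3 at `p` with constants `i` (`NobleAssumption43At`), the decidable sign conditions
  (N1′), (N2)–(N4) and the three caps give the extended simplified form `NobleSimplifiedFormF3At d p
  (β^corr(i)) (ofFn (extra^corr(i)))` — as `nobleSimplifiedFormF3At_percolation₈` (module `NobleSimplifiedFormF3AppD`)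
  with its hypothesis `PercolationNobleEquationAt d p` supplied by `percolationNobleEquationAt_of_summable` from the
  `N`-summability clauses of Assumption 4.3 itself ([FvdH17] Prop. 2.1);
* `nobleSimplifiedFormF3At_percolation_of_weaker` — the same at any WEAKER tables `(B', E')`
  (`BetaLE`/`BetaF3LE`, module `NobleSimplifiedFormF3Mono`): the form in which a numeric certificate stated over ONE
  rational table consumes it;
* `exists_keyBounds_and_split_percolation` — composed with `NobleSimplifiedFormF3At.exists_keyBounds_and_split`
  (module `NobleRemainderSymmetrisation`): under the bootstrap hypothesis `f₂(p) ≤ Γ₂` and the admissibility of the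
  weaker table (`0 < α̲'_F`, `β̲'_{ΔR,F} < α̲'_F`) there are totally-reflection-symmetric coefficients
  `c_Φ, α_Φ, c_F, α_F, R_Φ, R_F` of `τ̂_p` carrying all thirteen Assumption-2.7 bounds at `(B', E')` whose atoms satisfy
  `LapAtoms.KeyBounds (NobleBetaF3.toArgs d B' E' Γ₂)` at every `k ∈ [−π,π]^d` with `D̂(k) < 1`, together with
  `τ̂_p = Ĝ` and the App.-C split `−Δτ̂_p = Σ_{i=1}^5 Ĥ_i` there — exactly the inputs `hform`, `hRΦ`, `hRF`, `hRΦ2`,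
  `hRF2`, `hKB` of the (S2b)-IMPR assembly `NobleWeightedDiagramAssembly.abs_nobleH_le_boundHD75_of_pieces`.

So on the improvement window the analytic input of [NoBLE17] §3.3.4–3.3.5 is reduced to Assumption 4.3 (the
x-space diagrammatic bounds of [FvdH17] §§4–6) plus `f₂ ≤ Γ₂`; no App.-D or NoBLE-equation hypothesis remains.
d-generic; no numeral; nothing cited as a fact; additive (no existing module is modified).
-/

namespace Literature.Probability.FitznerVanDerHofstad2017

open scoped BigOperators
open Literature.Probability.LatticeModels
open Literature.Probability.Percolation
open Literature.Barriers.CriticalPhenomena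
open Literature.Probability.RandomPlanarGeometry.SAW.Zd (normSq)

variable {d : ℕ}

section Doorstep

variable {p : unitInterval} {i : BetaMap.Inputs}

variable (hd : 2 ≤ d) (hp : p < criticalProbI d)
include hd hp

/-- **[NoBLE17, Prop. 4.5 (ii)] with App. D discharged and the NoBLE equation derived.**  At `0 < p < p_c`,
Assumption 4.3 with constants `i`, well-formed inputs, the sign conditions (N1′), (N2)–(N4) and the caps
`μ ≤ 7/10`, `β̲_{ΣΠ_α} ≤ 1/8`, `(2d−1)·μ̄ ≤ 2d·μ` give the extended simplified form at the kernel-computed tables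
`(β^corr(i), extra^corr(i))`.  (`nobleSimplifiedFormF3At_percolation₈` with `PercolationNobleEquationAt d p` from the
`NSumLE` clauses `xiAbs`, `xiIotaAbs` of Assumption 4.3, [FvdH17] Prop. 2.1.)
[cite: FitznerVanDerHofstad2016NoBLE, Prop. 4.5 (p. 1088), App. D (pp. 1110–1117)] [cite: FitznerVanDerHofstad2017, Prop. 2.1 (EJP p. 10), §3.5] -/
theorem nobleSimplifiedFormF3At_percolation₉ (hp0 : 0 < (p : ℝ)) (hWF : NobleInputsWF d i)
    (h43 : NobleAssumption43At d p (percolationNobleSplit d p hd hp) i)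
    (hN1 : 0 ≤ BetaMap.betaCPhiLow d i.mu i.xiAlphaOneMinusZeroAtZero i.xiIotaAlphaIAtEi)
    (hN2 : i.xiAbs + i.xiIotaAbs < 1) (hN3 : (BetaMap.nobleBetaOfInputs d i).βΨ < 1)
    (hN4 : 0 ≤ (BetaMap.nobleBetaOfInputs d i).αFlow)
    (hcap : i.mu ≤ 7 / 10) (hcapP : i.piAlphaLower ≤ 1 / 8) (hcapQ : (2 * d - 1) * i.mub ≤ 2 * d * i.mu) :
    NobleSimplifiedFormF3At d p (BetaMap.nobleBetaOfInputsCorr d i)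
      (NobleBetaF3.ofFn (BetaMap.extraOfInputsCorr d i)) :=
  nobleSimplifiedFormF3At_percolation₈ hd hp hp0 hWF
    (percolationNobleEquationAt_of_summable hd hp hp0 h43.xiAbs.2.1 fun ι => (h43.xiIotaAbs ι).2.1)
    h43 hN1 hN2 hN3 hN4 hcap hcapP hcapQ

/-- The same at any WEAKER tables `(B', E')` (outward rounding: `BetaLE`, `BetaF3LE`) — the shape a numeric
certificate over one rational table consumes. [cite: FitznerVanDerHofstad2016NoBLE, Prop. 4.5 (p. 1088) and Assumption 2.7 (pp. 1059–1060)] -/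
theorem nobleSimplifiedFormF3At_percolation_of_weaker (hp0 : 0 < (p : ℝ)) (hWF : NobleInputsWF d i)
    (h43 : NobleAssumption43At d p (percolationNobleSplit d p hd hp) i)
    (hN1 : 0 ≤ BetaMap.betaCPhiLow d i.mu i.xiAlphaOneMinusZeroAtZero i.xiIotaAlphaIAtEi)
    (hN2 : i.xiAbs + i.xiIotaAbs < 1) (hN3 : (BetaMap.nobleBetaOfInputs d i).βΨ < 1)
    (hN4 : 0 ≤ (BetaMap.nobleBetaOfInputs d i).αFlow)
    (hcap : i.mu ≤ 7 / 10) (hcapP : i.piAlphaLower ≤ 1 / 8) (hcapQ : (2 * d - 1) * i.mub ≤ 2 * d * i.mu)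
    {B' : NobleBeta} {E' : NobleBetaF3} (hB : BetaLE (BetaMap.nobleBetaOfInputsCorr d i) B')
    (hE : BetaF3LE (NobleBetaF3.ofFn (BetaMap.extraOfInputsCorr d i)) E') :
    NobleSimplifiedFormF3At d p B' E' :=
  nobleSimplifiedFormF3At_mono hB hE
    (nobleSimplifiedFormF3At_percolation₉ hd hp hp0 hWF h43 hN1 hN2 hN3 hN4 hcap hcapP hcapQ)

/-- **The App.-D line at the `f₃` doorstep.**  At `0 < p < p_c`, `d ≥ 2`, under Assumption 4.3 with constants `i`
(well-formed, signs, caps as above), weaker admissible tables `(B', E')` (`0 < α̲'_F`, `β̲'_{ΔR,F} < α̲'_F`) and the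
bootstrap hypothesis `f₂(p) ≤ Γ₂`: there are totally reflection-symmetric, summable coefficients
`c_Φ, α_Φ, c_F, α_F, R_Φ, R_F` with the simplified rewrite `τ̂_p(k)[1 − F̂(k)] = Φ̂(k)` on the cube, `F̂(0) < 1`, all
thirteen Assumption-2.7 bounds at `(B', E')`, and, at every `k` of the cube with `D̂(k) < 1`, the key-quantity bounds
`LapAtoms.KeyBounds (NobleBetaF3.toArgs d B' E' Γ₂)`, `τ̂_p(k) = Ĝ(k)` and `−Δτ̂_p(k) = Σ_{i=1}^5 Ĥ_i(k)` — the
inputs of the (S2b)-IMPR assembly.  (`nobleSimplifiedFormF3At_percolation_of_weaker` ∘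
`NobleSimplifiedFormF3At.exists_keyBounds_and_split`.)
[cite: FitznerVanDerHofstad2016NoBLE, §3.3.4 (3.40)–(3.57) and §3.3.5 (pp. 1072–1079); Assumption 2.7 (pp. 1059–1060); Prop. 4.5 and App. D (pp. 1088, 1110–1117)] -/
theorem exists_keyBounds_and_split_percolation (hp0 : 0 < (p : ℝ)) (hWF : NobleInputsWF d i)
    (h43 : NobleAssumption43At d p (percolationNobleSplit d p hd hp) i)
    (hN1 : 0 ≤ BetaMap.betaCPhiLow d i.mu i.xiAlphaOneMinusZeroAtZero i.xiIotaAlphaIAtEi)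
    (hN2 : i.xiAbs + i.xiIotaAbs < 1) (hN3 : (BetaMap.nobleBetaOfInputs d i).βΨ < 1)
    (hN4 : 0 ≤ (BetaMap.nobleBetaOfInputs d i).αFlow)
    (hcap : i.mu ≤ 7 / 10) (hcapP : i.piAlphaLower ≤ 1 / 8) (hcapQ : (2 * d - 1) * i.mub ≤ 2 * d * i.mu)
    {B' : NobleBeta} {E' : NobleBetaF3} (hB : BetaLE (BetaMap.nobleBetaOfInputsCorr d i) B')
    (hE : BetaF3LE (NobleBetaF3.ofFn (BetaMap.extraOfInputsCorr d i)) E')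
    (hαFlow : 0 < B'.αFlow) (hgap : B'.βΔ < B'.αFlow) {Γ₂ : ℝ} (hΓ : nobleF2 d p ≤ Γ₂) :
    ∃ (cΦ αΦ cF αF : ℝ) (RΦ RF : Site d → ℝ), IsTRS RΦ ∧ IsTRS RF ∧ Summable RΦ ∧ Summable RF ∧
      (∀ k ∈ cube d, tauHat d p k * (1 - (cF + αF * Dhat d k + cosFT RF k)) =
        cΦ + αΦ * Dhat d k + cosFT RΦ k) ∧
      cF + αF + cosFT RF 0 < 1 ∧
      0 ≤ cΦ ∧ E'.cΦlow ≤ cΦ ∧ cΦ ≤ B'.cΦup ∧ |αΦ| ≤ B'.βαΦ ∧ B'.αFlow ≤ αF ∧ αF ≤ E'.αFup ∧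
      ∑' x, |RΦ x| ≤ B'.βRΦ ∧ ∑' x, |RF x| ≤ E'.βRF ∧
      Summable (fun x => normSq x * |RΦ x|) ∧ ∑' x, normSq x * |RΦ x| ≤ E'.βΔRΦ ∧
      Summable (fun x => normSq x * |RF x|) ∧ ∑' x, normSq x * |RF x| ≤ E'.βΔRFabs ∧
      (∀ k ∈ cube d, -(B'.βΔ * (1 - Dhat d k)) ≤ cosFT RF 0 - cosFT RF k) ∧
      ∀ k ∈ cube d, Dhat d k < 1 →
        (lapAtomsAt d cΦ αΦ cF αF RΦ RF k).KeyBounds (NobleBetaF3.toArgs d B' E' Γ₂) ∧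
        tauHat d p k = (lapAtomsAt d cΦ αΦ cF αF RΦ RF k).G ∧
        tauWHat d p k = (lapAtomsAt d cΦ αΦ cF αF RΦ RF k).H1 + (lapAtomsAt d cΦ αΦ cF αF RΦ RF k).H2 +
          (lapAtomsAt d cΦ αΦ cF αF RΦ RF k).H3 + (lapAtomsAt d cΦ αΦ cF αF RΦ RF k).H4 +
          (lapAtomsAt d cΦ αΦ cF αF RΦ RF k).H5 :=
  have hp' : (p : ℝ) < criticalProb (zdGraph d) (0 : Site d) := by exact_mod_cast hp
  (nobleSimplifiedFormF3At_percolation_of_weaker hd hp hp0 hWF h43 hN1 hN2 hN3 hN4 hcap hcapP hcapQ hB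
    hE).exists_keyBounds_and_split hd hp' hΓ hαFlow hgap

end Doorstep

end Literature.Probability.FitznerVanDerHofstad2017
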